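import Summits.CriticalPhenomena.PercolationContinuityZ3.Theorems.PercNearOneGluingNoHeavyLowerTailCovTransferTargetV
import HarnessLib

/-!
# Crux `NoHeavyLowerTail` (stmt-CriticalPhenomena-4575): the conditional covariance transfer COV-Π for every `v`-ANCHORED target

Support file (`--supports stmt-CriticalPhenomena-4575`, prim-hp-4 gen 9).  No named facts, no sorries, no `Prop` definitions.

COV-Π (prim-gen-induct's V3_tPi; the one hypothesis left in `…NoHeavyLowerTailSurplusTransferPair.lean`) for `ν = μ(·|a ↮ b)`, `D = {v↮a} ∩ {v↮b}`,
an increasing `f = F(C(b)) ≥ 0`:  `ν(D)·Cov_ν(f, 1{o ∈ C_b}) ≥ ν(o ↔ v, D)·Cov_ν(f, 1{v ∈ C_b})`.  Here it is PROVED for every monotone `F ≥ 0` that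
VANISHES on sets not containing `v` (targets "anchored at `v`"; `F = 1{v ∈ ·}` is `covTransfer_targetV`), in the denominator-free form (`Q = {a ↮ b}`)

  `μ(o↔v, D, Q)·[μ(Q)·∫_{v↔b, Q} f − μ(v↔b, Q)·∫_Q f] ≤ μ(D ∩ Q)·[μ(Q)·∫_{o↔b, Q} f − μ(o↔b, Q)·∫_Q f]`     (`covTransfer_anchored`),

literally the `f`-part of the hypothesis `hUT` of `SurplusTransfer.surplusTransfer_pair_of_plusTransfer`.
Proof (the ν′-trick of `covTransfer_targetV` plus one functional step): with `R = {a ↮ {b,v}}`, `U = {o ↔ {b,v}}`, `V₂ = Q ∩ {a ↔ v}`: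
(1′) `μ(R)·∫_{R∩U} f ≥ μ(R∩U)·∫_R f` (two-set association, `S = {a}`, `T = {b,v}`: `f` and `1_U` are increasing in `C_{{b,v}}`);
(s1) `μ(Q, v↮b)·μ(o↔b, V₂) ≤ μ(o↔b, v↮b, Q)·μ(V₂)` (two-set exchange, `S = {b}`, `T = {a,v}`: `{o∈C_b}` of type `(+)`, `{a↔v}` of type `(−)`);
(s2), (s3) the two exchanges of `covTransfer_targetV`; then bookkeeping (`f` vanishes off `{v ↔ b}`).
[cite: VandenbergHaggstromKahn2005, Thm. 2.1 (p. 9) at q = 1, Remark 1 (p. 5)]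
-/

noncomputable section

namespace Summit.CriticalPhenomena.PercolationContinuityZ3.Theorems.SurplusTransfer

open MeasureTheory Set
open Literature.Probability.LatticeModels (prodBernoulli)
open Literature.Probability.Percolation Literature.Probability.Percolation.KNPreFKG
open Literature.Probability.Percolation.TwoSetExchange

variable {V : Type*}

/-- For `a, v ∈ T`, the connection `{a ↔ v}` is of type `(−)` for `(C_S, C_T)` (it persists when `C_T` grows). [folklore] -/
theorem typeMinus_openConn_of_mem_mem (S T : Set V) {a v : V} (ha : a ∈ T)
    ⦃ω ω' : BondConfig V⦄
    (_hs : (⋃ s ∈ S, openEdgeCluster ω' s) ⊆ (⋃ s ∈ S, openEdgeCluster ω s))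
    (ht : (⋃ t ∈ T, openEdgeCluster ω t) ⊆ (⋃ t ∈ T, openEdgeCluster ω' t))
    (h : ω ∈ (openConn a v : Set (BondConfig V))) : ω' ∈ (openConn a v : Set (BondConfig V)) := by
  by_contra h'
  exact (typePlus_not_openConn_of_mem_mem S T ha (ω := ω') (ω' := ω) _hs ht h') h

section Measure

variable [Fintype V]

/-- **COV-Π for `v`-anchored targets.**  For `F` monotone, nonnegative, vanishing on vertex sets not containing `v` (`f = F(C(b))`), with
`Q = {a ↮ b}`, `D = {v ↮ a} ∩ {v ↮ b}`:
`μ(o↔v, D, Q)·[μ(Q)·∫_{v↔b,Q} f − μ(v↔b,Q)·∫_Q f] ≤ μ(D∩Q)·[μ(Q)·∫_{o↔b,Q} f − μ(o↔b,Q)·∫_Q f]`.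
[cite: VandenbergHaggstromKahn2005, Thm. 2.1 (p. 9) at q = 1, Remark 1 (p. 5)] -/
theorem covTransfer_anchored (w : Sym2 V → unitInterval) (o v a b : V) (F : Set V → ℝ)
    (hF : ∀ S T : Set V, S ⊆ T → F S ≤ F T) (hF0 : ∀ S, 0 ≤ F S) (hFv : ∀ S : Set V, v ∉ S → F S = 0) :
    (prodBernoulli w).real (({ω : BondConfig V | ¬ (openGraph ω).Reachable v a} ∩ {ω | ¬ (openGraph ω).Reachable v b}) ∩
          (openConn a b)ᶜ ∩ openConn o v) *
        ((prodBernoulli w).real ((openConn a b)ᶜ : Set (BondConfig V)) *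
            ∫ ω in (openConn v b ∩ (openConn a b)ᶜ : Set (BondConfig V)), F (openCluster ω b) ∂(prodBernoulli w) -
          (prodBernoulli w).real (openConn v b ∩ (openConn a b)ᶜ : Set (BondConfig V)) *
            ∫ ω in ((openConn a b)ᶜ : Set (BondConfig V)), F (openCluster ω b) ∂(prodBernoulli w)) ≤
      (prodBernoulli w).real (({ω : BondConfig V | ¬ (openGraph ω).Reachable v a} ∩ {ω | ¬ (openGraph ω).Reachable v b}) ∩
          (openConn a b)ᶜ) *
        ((prodBernoulli w).real ((openConn a b)ᶜ : Set (BondConfig V)) *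
            ∫ ω in (openConn o b ∩ (openConn a b)ᶜ : Set (BondConfig V)), F (openCluster ω b) ∂(prodBernoulli w) -
          (prodBernoulli w).real (openConn o b ∩ (openConn a b)ᶜ : Set (BondConfig V)) *
            ∫ ω in ((openConn a b)ᶜ : Set (BondConfig V)), F (openCluster ω b) ∂(prodBernoulli w)) := by
  classical
  set μ := prodBernoulli w with hμ
  set f : BondConfig V → ℝ := fun ω => F (openCluster ω b) with hf
  have hmeas : ∀ T : Set (BondConfig V), MeasurableSet T := fun _ => MeasurableSet.of_discrete
  have hint : ∀ (k : BondConfig V → ℝ) (T : Set (BondConfig V)), IntegrableOn k T μ :=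
    fun k T => (Integrable.of_finite).integrableOn
  have hn := fun (S : Set (BondConfig V)) => (measureReal_nonneg : 0 ≤ μ.real S)
  -- names (as in `covTransfer_targetV`)
  set Q : Set (BondConfig V) := (openConn a b)ᶜ with hQ
  set R : Set (BondConfig V) := {ω | ¬ (openGraph ω).Reachable a b} ∩ {ω | ¬ (openGraph ω).Reachable a v} with hR
  set Nv : Set (BondConfig V) := (openConn v b)ᶜ with hNv
  set Na : Set (BondConfig V) := (openConn v a)ᶜ with hNa
  set Ob : Set (BondConfig V) := openConn o b with hOb
  set Vb : Set (BondConfig V) := openConn v b with hVb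
  set Ov : Set (BondConfig V) := openConn o v with hOv
  set U : Set (BondConfig V) := openConn b o ∪ openConn v o with hU
  have hRdef : ∀ ω : BondConfig V, ω ∈ R ↔ ¬ (openGraph ω).Reachable a b ∧ ¬ (openGraph ω).Reachable a v := fun ω => Iff.rfl
  -- `f` vanishes off `{v ↔ b}`
  have hfv : ∀ ω : BondConfig V, ω ∉ Vb → f ω = 0 := fun ω hω => hFv _ (fun h => hω (h.symm : (openGraph ω).Reachable v b))
  have hf0 : ∀ ω, 0 ≤ f ω := fun ω => hF0 _
  have hrestrict : ∀ S : Set (BondConfig V), ∫ ω in S, f ω ∂μ = ∫ ω in S ∩ Vb, f ω ∂μ := by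
    intro S
    rw [← integral_inter_add_sdiff (hmeas Vb) (hint f S)]
    have : ∫ ω in S \ Vb, f ω ∂μ = 0 :=
      (setIntegral_congr_fun ((hmeas S).diff (hmeas Vb)) (g := fun _ => (0 : ℝ)) fun ω hω => hfv ω hω.2).trans (by simp)
    rw [this, add_zero]
  -- (s2), (s3): the exchanges of `covTransfer_targetV`, world `S = {a}`, `T = {b, v}`; and (F2) world `S = {b}`, `T = {v, a}`
  have hF2 := setTwoClusterExchange w ({b} : Set V) ({v, a} : Set V)
    (A₁ := openConn b o) (B₁ := univ) (A₂ := (openConn v a : Set (BondConfig V))ᶜ) (B₂ := univ)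
    (typePlus_openConn_of_mem {b} {v, a} (by simp) o)
    (typePlus_not_openConn_of_mem_mem {b} {v, a} (by simp))
    (fun _ _ _ _ _ => mem_univ _) (fun _ _ _ _ _ => mem_univ _)
  have h1 := setTwoClusterExchange w ({a} : Set V) ({b, v} : Set V)
    (A₁ := univ) (B₁ := ⋃ t ∈ ({b, v} : Set V), (openConn t o : Set (BondConfig V))) (A₂ := univ) (B₂ := openConn b v)
    (fun _ _ _ _ _ => mem_univ _) (fun _ _ _ _ _ => mem_univ _)
    (typeMinus_biUnion_openConn {a} {b, v} o) (typeMinus_openConn_of_mem {a} {b, v} (by simp) v)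
  have h2 := setTwoClusterExchange w ({a} : Set V) ({b, v} : Set V)
    (A₁ := (openConn b v : Set (BondConfig V))ᶜ) (B₁ := ⋃ t ∈ ({b, v} : Set V), (openConn t o : Set (BondConfig V)))
    (A₂ := univ) (B₂ := univ)
    (typePlus_not_openConn_of_mem {a} {b, v} (by simp) v) (fun _ _ _ _ _ => mem_univ _)
    (typeMinus_biUnion_openConn {a} {b, v} o) (fun _ _ _ _ _ => mem_univ _)
  -- (s1): world `S = {b}`, `T = {v, a}`: `{b ↔ o}` (+) vs `{a ↔ v}` (−)
  have hS1 := setTwoClusterExchange w ({b} : Set V) ({v, a} : Set V)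
    (A₁ := openConn b o) (B₁ := openConn v a) (A₂ := univ) (B₂ := univ)
    (typePlus_openConn_of_mem {b} {v, a} (by simp) o) (fun _ _ _ _ _ => mem_univ _)
    (typeMinus_openConn_of_mem_mem {b} {v, a} (show v ∈ ({v, a} : Set V) by simp))
    (fun _ _ _ _ _ => mem_univ _)
  simp only [sep_singleton_pair, inter_univ, univ_inter, biUnion_pair_openConn] at hF2 h1 h2 hS1
  rw [openConn_symm b o] at hF2 hS1
  rw [openConn_symm b v] at h1 h2
  have hDb : {ω : BondConfig V | ¬ (openGraph ω).Reachable b v} ∩ {ω | ¬ (openGraph ω).Reachable b a} = Nv ∩ Q := by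
    ext ω; simp only [mem_inter_iff, mem_setOf_eq, mem_compl_iff, openConn, hNv, hQ]
    exact ⟨fun ⟨h1, h2⟩ => ⟨fun h => h1 h.symm, fun h => h2 h.symm⟩, fun ⟨h1, h2⟩ => ⟨fun h => h1 h.symm, fun h => h2 h.symm⟩⟩
  rw [hDb] at hF2 hS1
  change μ.real (Nv ∩ Q ∩ Ob) * μ.real (Nv ∩ Q ∩ Na) ≤ μ.real (Nv ∩ Q ∩ (Ob ∩ Na)) * μ.real (Nv ∩ Q) at hF2
  change μ.real (R ∩ U) * μ.real (R ∩ Vb) ≤ μ.real R * μ.real (R ∩ (U ∩ Vb)) at h1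
  change μ.real (R ∩ (Vbᶜ ∩ U)) * μ.real R ≤ μ.real (R ∩ Vbᶜ) * μ.real (R ∩ U) at h2
  change μ.real (Nv ∩ Q ∩ (Ob ∩ openConn v a)) * μ.real (Nv ∩ Q) ≤ μ.real (Nv ∩ Q ∩ Ob) * μ.real (Nv ∩ Q ∩ openConn v a) at hS1
  -- (1′): functional two-set association, world `S = {a}`, `T = {b, v}`: `f` and `1_U` increasing in `C_T`
  have hG1 : ∀ C : Set (Sym2 V), Antitone fun E : Set (Sym2 V) => -F (openCluster E b) :=
    fun C E E' h => neg_le_neg (hF _ _ (openCluster_mono h b))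
  have hG2 : ∀ C : Set (Sym2 V), Antitone fun E : Set (Sym2 V) =>
      -(if o ∈ openCluster E b ∪ openCluster E v then (1 : ℝ) else 0) := by
    intro C E E' h
    apply neg_le_neg
    by_cases ho : o ∈ openCluster E b ∪ openCluster E v
    · rw [if_pos ho, if_pos (show o ∈ openCluster E' b ∪ openCluster E' v from
        ho.elim (fun h' => Or.inl (openCluster_mono h b h')) (fun h' => Or.inr (openCluster_mono h v h')))]
    · rw [if_neg ho]; split_ifs <;> norm_num
  have hassoc := BHK2006_twoSetConditionalAssociation w ({a} : Set V) ({b, v} : Set V)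
    (fun _ E => -F (openCluster E b)) (fun _ E => -(if o ∈ openCluster E b ∪ openCluster E v then (1 : ℝ) else 0))
    (fun _ => monotone_const) hG1 (fun _ => monotone_const) hG2
  have hev1 : ∀ ω : BondConfig V, F (openCluster (⋃ t ∈ ({b, v} : Set V), openEdgeCluster ω t) b) = f ω := fun ω => by
    rw [openCluster_biUnion_eq (show b ∈ ({b, v} : Set V) by simp)]
  have hev2 : ∀ ω : BondConfig V, (if o ∈ openCluster (⋃ t ∈ ({b, v} : Set V), openEdgeCluster ω t) b ∪
      openCluster (⋃ t ∈ ({b, v} : Set V), openEdgeCluster ω t) v then (1 : ℝ) else 0) = U.indicator (1 : BondConfig V → ℝ) ω := by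
    intro ω
    rw [openCluster_biUnion_eq (show b ∈ ({b, v} : Set V) by simp), openCluster_biUnion_eq (show v ∈ ({b, v} : Set V) by simp)]
    by_cases hω : ω ∈ U
    · rw [indicator_of_mem hω, Pi.one_apply, if_pos]
      rcases hω with h | h
      · exact Or.inl (h : (openGraph ω).Reachable b o)
      · exact Or.inr (h : (openGraph ω).Reachable v o)
    · rw [indicator_of_notMem hω, if_neg]
      rintro (h | h)
      · exact hω (Or.inl h)
      · exact hω (Or.inr h)
  simp only [sep_singleton_pair, hev1, hev2, integral_neg, mul_neg, neg_mul, neg_neg] at hassoc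
  rw [setIntegral_indicator_one_eq] at hassoc
  have hprodU : ∫ ω in R, f ω * U.indicator (1 : BondConfig V → ℝ) ω ∂μ = ∫ ω in R ∩ U, f ω ∂μ :=
    setIntegral_mul_indicator_one μ R U f
  have hassoc' : (∫ ω in R, f ω ∂μ) * μ.real (R ∩ U) ≤ μ.real R * ∫ ω in R ∩ U, f ω ∂μ := by
    have := hassoc
    rw [← hR, ← hμ, hprodU] at this
    exact this
  -- set identities
  have eVb : (Vb ∩ Q : Set (BondConfig V)) = R ∩ Vb := by
    ext ω; simp only [mem_inter_iff, mem_compl_iff, openConn, mem_setOf_eq, hVb, hQ, hRdef]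
    constructor
    · rintro ⟨hvb, hab⟩; exact ⟨⟨hab, fun hav => hab (hav.trans hvb)⟩, hvb⟩
    · rintro ⟨⟨hab, _⟩, hvb⟩; exact ⟨hvb, hab⟩
  have eOVb : (Ob ∩ Q ∩ Vb : Set (BondConfig V)) = R ∩ U ∩ Vb := by
    ext ω; simp only [mem_inter_iff, mem_compl_iff, mem_union, openConn, mem_setOf_eq, hVb, hQ, hOb, hU, hRdef]
    constructor
    · rintro ⟨⟨hob, hab⟩, hvb⟩; exact ⟨⟨⟨hab, fun hav => hab (hav.trans hvb)⟩, Or.inl hob.symm⟩, hvb⟩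
    · rintro ⟨⟨⟨hab, _⟩, h | h⟩, hvb⟩
      · exact ⟨⟨h.symm, hab⟩, hvb⟩
      · exact ⟨⟨h.symm.trans hvb, hab⟩, hvb⟩
  have eQVb : (Q ∩ Vb : Set (BondConfig V)) = R ∩ Vb := by rw [inter_comm]; exact eVb
  have eRVb_int : ∫ ω in R, f ω ∂μ = ∫ ω in R ∩ Vb, f ω ∂μ := hrestrict R
  have eRUVb_int : ∫ ω in R ∩ U, f ω ∂μ = ∫ ω in R ∩ U ∩ Vb, f ω ∂μ := hrestrict (R ∩ U)
  have eDQ : ({ω : BondConfig V | ¬ (openGraph ω).Reachable v a} ∩ {ω | ¬ (openGraph ω).Reachable v b}) ∩ Q = R ∩ Vbᶜ := by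
    ext ω; simp only [mem_inter_iff, mem_compl_iff, openConn, mem_setOf_eq, hQ, hVb, hRdef]
    constructor
    · rintro ⟨⟨hva, hvb⟩, hab⟩; exact ⟨⟨hab, fun h => hva h.symm⟩, hvb⟩
    · rintro ⟨⟨hab, hav⟩, hvb⟩; exact ⟨⟨fun h => hav h.symm, hvb⟩, hab⟩
  have eNQNa : Nv ∩ Q ∩ Na = R ∩ Vbᶜ := by
    ext ω; simp only [mem_inter_iff, mem_compl_iff, openConn, mem_setOf_eq, hNv, hQ, hNa, hVb, hRdef]
    constructor
    · rintro ⟨⟨hvb, hab⟩, hva⟩; exact ⟨⟨hab, fun h => hva h.symm⟩, hvb⟩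
    · rintro ⟨⟨hab, hav⟩, hvb⟩; exact ⟨⟨hvb, hab⟩, fun h => hav h.symm⟩
  have eOvDQ : ({ω : BondConfig V | ¬ (openGraph ω).Reachable v a} ∩ {ω | ¬ (openGraph ω).Reachable v b}) ∩ Q ∩ Ov =
      (R ∩ (Vbᶜ ∩ U)) \ (Nv ∩ Q ∩ (Ob ∩ Na)) := by
    ext ω
    simp only [mem_inter_iff, mem_compl_iff, mem_sdiff, mem_union, openConn, mem_setOf_eq, hNv, hQ, hNa, hVb, hOv, hOb, hU, hRdef]
    constructor
    · rintro ⟨⟨⟨hva, hvb⟩, hab⟩, hov⟩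
      refine ⟨⟨⟨hab, fun hav => hva hav.symm⟩, hvb, Or.inr hov.symm⟩, ?_⟩
      rintro ⟨⟨_, _⟩, hob, _⟩
      exact hvb (hov.symm.trans hob)
    · rintro ⟨⟨⟨hab, hav⟩, hvb, hU'⟩, hnot⟩
      rcases hU' with hob | hvo
      · exact absurd ⟨⟨hvb, hab⟩, hob.symm, fun h => hav h.symm⟩ hnot
      · exact ⟨⟨⟨fun h => hav h.symm, hvb⟩, hab⟩, hvo.symm⟩
  have hsubU : Nv ∩ Q ∩ (Ob ∩ Na) ⊆ R ∩ (Vbᶜ ∩ U) := by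
    intro ω hω
    simp only [mem_inter_iff, mem_compl_iff, mem_union, openConn, mem_setOf_eq, hNv, hQ, hNa, hVb, hOb, hU, hRdef] at hω ⊢
    obtain ⟨⟨hvb, hab⟩, hob, hva⟩ := hω
    exact ⟨⟨hab, fun h => hva h.symm⟩, hvb, Or.inl hob.symm⟩
  have eOvR : μ.real (({ω : BondConfig V | ¬ (openGraph ω).Reachable v a} ∩ {ω | ¬ (openGraph ω).Reachable v b}) ∩ Q ∩ Ov) =
      μ.real (R ∩ (Vbᶜ ∩ U)) - μ.real (Nv ∩ Q ∩ (Ob ∩ Na)) := by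
    rw [eOvDQ, measureReal_sdiff hsubU (hmeas _)]
  -- `Q = R ⊔ V₂` (`V₂ = Q ∩ {v ↔ a}`), splits of `μ(Ob ∩ Q)`, `μ(R ∩ U)`, `μ(Nv ∩ Q)`, `μ(R)`
  have eQR : Q \ (openConn v a : Set (BondConfig V)) = R := by
    ext ω; simp only [mem_sdiff, mem_compl_iff, openConn, mem_setOf_eq, hQ, hRdef]
    exact ⟨fun ⟨hab, hva⟩ => ⟨hab, fun h => hva h.symm⟩, fun ⟨hab, hav⟩ => ⟨hab, fun h => hav h.symm⟩⟩
  have eQsplit : μ.real Q = μ.real R + μ.real (Q ∩ openConn v a) := by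
    have := measureReal_inter_add_sdiff (s := Q) (h := measure_ne_top (μ := μ) _) (hmeas (openConn v a))
    rw [eQR] at this; linarith
  have eNvQ1 : (Nv ∩ Q) \ (openConn v a : Set (BondConfig V)) = R ∩ Vbᶜ := by
    rw [← eNQNa]; ext ω; simp only [mem_sdiff, mem_inter_iff, mem_compl_iff, hNa]
  have eNvQ2 : (Nv ∩ Q) ∩ (openConn v a : Set (BondConfig V)) = Q ∩ openConn v a := by
    ext ω; simp only [mem_inter_iff, mem_compl_iff, openConn, mem_setOf_eq, hQ, hNv, hVb]
    constructor
    · rintro ⟨⟨_, hab⟩, hva⟩; exact ⟨hab, hva⟩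
    · rintro ⟨hab, hva⟩; exact ⟨⟨fun hvb => hab (hva.symm.trans hvb), hab⟩, hva⟩
  have eNvQ : μ.real (Nv ∩ Q) = μ.real (R ∩ Vbᶜ) + μ.real (Q ∩ openConn v a) := by
    have := measureReal_inter_add_sdiff (s := Nv ∩ Q) (h := measure_ne_top (μ := μ) _) (hmeas (openConn v a))
    rw [eNvQ1, eNvQ2] at this; linarith
  have eV2 : Nv ∩ Q ∩ (openConn v a : Set (BondConfig V)) = Q ∩ openConn v a := eNvQ2
  have eOb1 : (Ob ∩ Q : Set (BondConfig V)) ∩ Vb = R ∩ U ∩ Vb := eOVb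
  have eOb2 : ((Ob ∩ Q : Set (BondConfig V)) \ Vb) ∩ Na = Nv ∩ Q ∩ (Ob ∩ Na) := by
    ext ω; simp only [mem_inter_iff, mem_sdiff, hNv, mem_compl_iff]; tauto
  have eOb3 : ((Ob ∩ Q : Set (BondConfig V)) \ Vb) \ Na = Nv ∩ Q ∩ (Ob ∩ openConn v a) := by
    ext ω; simp only [mem_inter_iff, mem_sdiff, hNv, hNa, mem_compl_iff, not_not]; tauto
  have eObQ : μ.real (Ob ∩ Q : Set (BondConfig V)) =
      μ.real (R ∩ U ∩ Vb) + μ.real (Nv ∩ Q ∩ (Ob ∩ Na)) + μ.real (Nv ∩ Q ∩ (Ob ∩ openConn v a)) := by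
    have s1 := measureReal_inter_add_sdiff (s := (Ob ∩ Q : Set (BondConfig V))) (h := measure_ne_top (μ := μ) _) (hmeas Vb)
    have s2 := measureReal_inter_add_sdiff (s := ((Ob ∩ Q : Set (BondConfig V)) \ Vb)) (h := measure_ne_top (μ := μ) _) (hmeas Na)
    rw [eOb1] at s1; rw [eOb2, eOb3] at s2; linarith
  have eRU1 : (R ∩ U) \ Vb = R ∩ (Vbᶜ ∩ U) := by
    ext ω; simp only [mem_inter_iff, mem_sdiff, mem_compl_iff]; tauto
  have eRU : μ.real (R ∩ U) = μ.real (R ∩ U ∩ Vb) + μ.real (R ∩ (Vbᶜ ∩ U)) := by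
    have := measureReal_inter_add_sdiff (s := R ∩ U) (h := measure_ne_top (μ := μ) _) (hmeas Vb)
    rw [eRU1] at this; linarith
  have eRUVb : (R ∩ (U ∩ Vb) : Set (BondConfig V)) = R ∩ U ∩ Vb := (inter_assoc _ _ _).symm
  have eRsplit : μ.real R = μ.real (R ∩ Vb) + μ.real (R ∩ Vbᶜ) := by
    have := measureReal_inter_add_sdiff (s := R) (h := measure_ne_top (μ := μ) _) (hmeas Vb)
    rw [Set.sdiff_eq] at this; linarith
  rw [eV2] at hS1
  -- rewrite the goal
  rw [eOvR, eDQ, hrestrict (Ob ∩ Q), hrestrict Q, eOVb, eQVb, eVb]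
  rw [eRVb_int, eRUVb_int, eRU] at hassoc'
  rw [eRUVb] at h1
  rw [eNQNa] at hF2
  -- reals
  set r := μ.real R
  set mV2 := μ.real (Q ∩ openConn v a)
  set dR := μ.real (R ∩ Vbᶜ)
  set dQ := μ.real (Nv ∩ Q)
  set oLvQ := μ.real (Nv ∩ Q ∩ Ob)
  set oLvR := μ.real (Nv ∩ Q ∩ (Ob ∩ Na))
  set oV2 := μ.real (Nv ∩ Q ∩ (Ob ∩ openConn v a))
  set vLR := μ.real (R ∩ Vb)
  set UvL := μ.real (R ∩ U ∩ Vb)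
  set UnR := μ.real (R ∩ (Vbᶜ ∩ U))
  set G1 := ∫ ω in R ∩ Vb, f ω ∂μ
  set GO := ∫ ω in R ∩ U ∩ Vb, f ω ∂μ
  have hG1 : 0 ≤ G1 := setIntegral_nonneg (hmeas _) fun ω _ => hf0 ω
  have hdR0 : 0 ≤ dR := measureReal_nonneg
  have hmV20 : 0 ≤ mV2 := measureReal_nonneg
  have hq : μ.real Q = r + mV2 := eQsplit
  rw [hq, eObQ]
  -- hF2 : oLvQ * dR ≤ oLvR * dQ;  hS1 : oV2 * dQ ≤ oLvQ * mV2;  h1 : UR vLR ≤ r UvL; h2 : UnR r ≤ dR UR; hassoc' : G1 * UR ≤ r * GO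
  have hUR : μ.real (R ∩ U) = UvL + UnR := eRU
  rw [hUR] at h1 h2
  rw [eNvQ] at hF2 hS1
  have hr : r = vLR + dR := eRsplit
  -- key f-free inequality chain
  by_cases hr0 : r = 0
  · have hvLR : vLR = 0 := by linarith only [hr0, hr, hn (R ∩ Vb), hdR0]
    have hdR : dR = 0 := by linarith only [hr0, hr, hn (R ∩ Vb), hdR0]
    have hG10 : G1 = 0 := by
      apply setIntegral_measure_zero
      exact (measureReal_eq_zero_iff (measure_ne_top _ _)).1 hvLR
    have hGO0 : GO = 0 := by
      apply setIntegral_measure_zero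
      have : μ.real (R ∩ U ∩ Vb) = 0 :=
        le_antisymm (hvLR ▸ measureReal_mono (by intro ω hω; exact ⟨hω.1.1, hω.2⟩) (measure_ne_top _ _)) (hn _)
      exact (measureReal_eq_zero_iff (measure_ne_top _ _)).1 this
    rw [hG10, hGO0, hdR]; simp
  · have hrpos : 0 < r := lt_of_le_of_ne (hn _) (Ne.symm hr0)
    -- hkey : vLR * UnR ≤ dR * UvL (as in `covTransfer_targetV`)
    have hstep : r * (dR * UvL) ≥ r * (vLR * UnR) :=
      calc r * (dR * UvL) = dR * (r * UvL) := by ring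
        _ ≥ dR * ((UvL + UnR) * vLR) := mul_le_mul_of_nonneg_left h1 (hn _)
        _ = vLR * (dR * (UvL + UnR)) := by ring
        _ ≥ vLR * (UnR * r) := mul_le_mul_of_nonneg_left h2 (hn _)
        _ = r * (vLR * UnR) := by ring
    have hkey : vLR * UnR ≤ dR * UvL := le_of_mul_le_mul_left hstep hrpos
    -- oV2 * dR ≤ oLvR * mV2   (from hS1, hF2)
    have hV2o : oV2 * dR * (dR + mV2) ≤ oLvR * mV2 * (dR + mV2) := by
      have e1 : oV2 * (dR + mV2) * dR ≤ oLvQ * mV2 * dR := mul_le_mul_of_nonneg_right hS1 (hn _)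
      have e2 : oLvQ * dR * mV2 ≤ oLvR * (dR + mV2) * mV2 := mul_le_mul_of_nonneg_right hF2 (hn _)
      linarith only [e1, e2]
    have hV2o' : oV2 * dR ≤ oLvR * mV2 := by
      by_cases hd : dR + mV2 = 0
      · have h0 : dR = 0 := by linarith only [hd, hdR0, hmV20]
        have h0' : mV2 = 0 := by linarith only [hd, hdR0, hmV20]
        rw [h0, h0', mul_zero, mul_zero]
      · exact le_of_mul_le_mul_right hV2o (lt_of_le_of_ne (add_nonneg hdR0 hmV20) (Ne.symm hd))
    -- `G1 · UnR ≤ dR · GO`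
    have hkeyf : G1 * UnR ≤ dR * GO := by
      have hstep2 : r * (G1 * UnR) ≤ r * (dR * GO) :=
        calc r * (G1 * UnR) = G1 * (vLR * UnR) + dR * (G1 * UnR) := by rw [hr]; ring
          _ ≤ G1 * (dR * UvL) + dR * (G1 * UnR) := by linarith only [mul_le_mul_of_nonneg_left hkey hG1]
          _ = dR * (G1 * (UvL + UnR)) := by ring
          _ ≤ dR * (r * GO) := mul_le_mul_of_nonneg_left hassoc' (hn _)
          _ = r * (dR * GO) := by ring
      exact le_of_mul_le_mul_left hstep2 hrpos
    -- final bookkeeping (substitute `r = vLR + dR`)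
    have b1 : 0 ≤ r * GO - G1 * (UvL + UnR) := by linarith only [hassoc']
    have b2 : 0 ≤ dR * GO - G1 * UnR := by linarith only [hkeyf]
    have b3 : 0 ≤ oLvR * mV2 - oV2 * dR := by linarith only [hV2o']
    have p1 := mul_nonneg hdR0 b1
    have p2 := mul_nonneg hmV20 b2
    have p3 := mul_nonneg hG1 b3
    rw [hr] at p1 ⊢
    linarith only [p1, p2, p3]

end Measure

end Summit.CriticalPhenomena.PercolationContinuityZ3.Theorems.SurplusTransfer

end
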